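import Summits.CriticalPhenomena.PercolationContinuityZ3.Theorems.Transplant.SkelPhiVLineExitGoals
import Summits.CriticalPhenomena.PercolationContinuityZ3.Theorems.Transplant.SkelPhiRootServeTable
import HarnessLib

/-!
# N1 (the `{±1}` node), LEVEL 1, kit adapter file N-K8i: **THE LINE-FORM EXIT TABLE `pexVL` IS A SERVED EVENT** — twin of p3-g9's
# `SkelPhiRootServeTable` (`pexRaw/pexLev_eq_pieceNAt`, `real_pexXO/YO/RO_gt`) for p1-g12's `pexVL` (v-face level exits, `SkelPhiVLineExitGoals`):
# every entry of `pexVL G φ Q C a b e c` IS one of the eight realised Step-I″ pieces `pieceNAt G φK D t c M n fam σ' τ'` of the kit pair in its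
# own orientation `φK = oriφ φ (Q.oS c)` (`pexVL_eq_pieceNAt`), so the kit clause's `hexit` hypothesis for it follows from the served inputs at
# `c` over ALL `(fam, σ', τ')` (`real_pexVL_gt`) — the consumer ((F), hp-8 g33's v-face kits) never inspects the table

builds on p205010 (kernel theorem, internal audit signed; external expert review pending) — nothing in this file uses p205010; nothing here is a
claim about the open node `SamePDropOfSkeletonNeg₁`.
Lane `prim-bschramm`, seat `prim-bschramm-p1` (gen 12; kit-layer defect desk); helper file (`--supports stmt-CriticalPhenomena-4575 --as helper`).
[cite: KozmaNitzan2024, §4 pp. 19–21 ((21)–(25))] [cite: MartineauTassion2017, §3.2]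
-/

noncomputable section

open scoped Classical

namespace Summit.CriticalPhenomena.PercolationContinuityZ3.Theorems.Transplant

namespace Skelφ

open MeasureTheory Literature.Probability.Percolation Literature.Probability.LatticeModels SimpleGraph KNLevels
open StepI (DataN pieceNAt regionNAt)

variable {V : Type} {G : SimpleGraph V} [G.LocallyFinite] {φ : V → Site 2}

/-! ## §1 Every entry of `pexVL` is a realised piece -/

section Pieces

variable {Q : ShortPcO V} {D : DataN V} {t c : V} {M n : ℕ}
  (hn : Q.nS c = n) (hh : Q.hS c = D.hgt t M n) (hℓ : Q.ℓS c = D.len t M n) (hR : Q.RS c = D.R (D.scale t M n))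
include hn hh hℓ hR

/-- **Every line-form table entry is a realised piece** of the kit pair in its own orientation. [this work] -/
theorem pexVL_eq_pieceNAt (hv : Q.vS c = D.spl t M n) (C : ℕ) (a b : ℤ) {e : ℤ} (he : e = 1 ∨ e = -1) :
    ∃ (fam : Fin 2) (σ' τ' : ℤˣ), pexVL G φ Q C a b e c = pieceNAt G (oriφ φ (Q.oS c)) D t c M n fam σ' τ' := by
  have hsg : ∀ x : ℤ, e * sgnz x = 1 ∨ e * sgnz x = -1 := fun x => by
    rcases he with rfl | rfl <;> rcases sgnz_cases x with h | h <;> simp [h]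
  unfold pexVL
  cases hQ : Q.oS c
  · simp only [Bool.false_eq_true, if_false, oriφ_false]
    split_ifs
    · refine ⟨0, sgnU (e * sgnz ((Q.nS c : ℤ) * b + Q.hS c * a)), sgnU (e * sgnz a), ?_⟩
      unfold pieceNAt; rw [if_pos rfl, val_sgnU (hsg _), val_sgnU (hsg _), hn, hh, hℓ, hR]
    · refine ⟨1, sgnU (e * sgnz a), 1, ?_⟩
      unfold pieceNAt; rw [if_neg (by decide), val_sgnU (hsg _), Units.val_one, hn, hh, hℓ, hR, hv]
  · simp only [if_true, oriφ_true]
    split_ifs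
    · refine ⟨0, sgnU (e * sgnz ((Q.nS c : ℤ) * a + Q.hS c * b)), sgnU (e * sgnz b), ?_⟩
      unfold pieceNAt; rw [if_pos rfl, val_sgnU (hsg _), val_sgnU (hsg _), hn, hh, hℓ, hR]
    · refine ⟨1, sgnU (e * sgnz b), 1, ?_⟩
      unfold pieceNAt; rw [if_neg (by decide), val_sgnU (hsg _), Units.val_one, hn, hh, hℓ, hR, hv]

end Pieces

/-! ## §2 The `hexit` hypothesis for `pexVL` from the served inputs -/

section Served

variable {Q : ShortPcO V} {D : DataN V} {t : V} {M n : ℕ} {q : unitInterval} {δ : ℝ} {Λ : V → ℕ → Finset V} {k : ℕ}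
  (hQ : ∀ c, Q.nS c = n ∧ Q.hS c = D.hgt t M n ∧ Q.ℓS c = D.len t M n ∧ Q.RS c = D.R (D.scale t M n) ∧ Q.vS c = D.spl t M n)
  (hserved : ∀ (c : V) (fam : Fin 2) (σ' τ' : ℤˣ), 1 - δ < (bondPercolation G q).real
    (linkIn (regionNAt G (oriφ φ (Q.oS c)) D t c M n) (Λ c k) (pieceNAt G (oriφ φ (Q.oS c)) D t c M n fam σ' τ')))
include hQ hserved

/-- **`hexit` for the line-form table** from the served inputs at every centre, for every coefficient pair `(a, b)`, threshold `C` and exit sign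
`e = ±1` (hence for any assignment of forms to sides `(i, σ₀)` the consumer chooses). [cite: KozmaNitzan2024, §4 pp. 19–21] -/
theorem real_pexVL_gt (C : ℕ) (a b : ℤ) {e : ℤ} (he : e = 1 ∨ e = -1) (c : V) :
    1 - δ < (bondPercolation G q).real (linkIn (↑(RgO G φ Q c) : Set V) (Λ c k) (pexVL G φ Q C a b e c)) := by
  obtain ⟨hn, hh, hℓ, hR, hv⟩ := hQ c
  rw [coe_RgO_eq_regionNAt hn hh hℓ hR]
  obtain ⟨fam, σ', τ', hp⟩ := pexVL_eq_pieceNAt (G := G) (φ := φ) hn hh hℓ hR hv C a b he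
  rw [hp]; exact hserved c fam σ' τ'

/-- The same, packaged for a side-indexed family of forms `(a i σ₀, b i σ₀)` and signs `e i σ₀ = ±1` (the shape of `hexit : ∀ c i σ₀, …` in
`kitClause_frame`-type clauses with `Pex i σ₀ c := pexVL G φ Q C (a i σ₀) (b i σ₀) (e i σ₀) c`). [cite: KozmaNitzan2024, §4 pp. 19–21] -/
theorem real_pexVL_gt_family (C : ℕ) (a b e : Fin 2 → ℤˣ → ℤ) (he : ∀ i σ₀, e i σ₀ = 1 ∨ e i σ₀ = -1) :
    ∀ (c : V) (i : Fin 2) (σ₀ : ℤˣ), 1 - δ < (bondPercolation G q).real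
      (linkIn (↑(RgO G φ Q c) : Set V) (Λ c k) (pexVL G φ Q C (a i σ₀) (b i σ₀) (e i σ₀) c)) :=
  fun c i σ₀ => real_pexVL_gt hQ hserved C (a i σ₀) (b i σ₀) (he i σ₀) c

end Served

end Skelφ

end Summit.CriticalPhenomena.PercolationContinuityZ3.Theorems.Transplant

end
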